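import Mathlib
import HarnessLib
import Literature.NumberTheory.LFunctions.GeneralizedRH
import Literature.NumberTheory.LFunctions.HorocycleRH
import Literature.NumberTheory.LFunctions.HorocycleRHIncompleteEisenstein

/-!
# Proof of Zagier's criterion: horocycle rate `θ` forces `ζ ≠ 0` on `2 − 2θ < re s < 1`

Discharge of the named facts `Literature.NumberTheory.LFunctions.quasiRH_of_horocycleRate` (Zagier 1981, §1 pp. 279–280,
direction (Z2): "if `C(F;y) = κ + O(y^α)` then `I(F;s) − κ/(s−1)` is holomorphic for
`re s > 1 − α` … then the Riemann hypothesis is true!") and, through the reduction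
`riemannHypothesis_of_horocycleRate_threeQuarters_of` of `HorocycleRH.lean`, of
`Literature.NumberTheory.LFunctions.riemannHypothesis_of_horocycleRate_threeQuarters`.

## Part 1. Mellin transforms of the unfolded horocycle average

With `g_c(y) = ∫_ℝ ψ(y/(c²(u²+y²))) du = y G(c² y)`, `G(u) = ∫_ℝ ψ(1/(u(1+t²))) dt`
(`HorocycleRHIncompleteEisenstein.lean`), we compute for `re s > 1/2`
`∫₀^∞ u^{s-1} G(u) du = B(s) M(s)`, `B(s) = ∫_ℝ (1+t²)^{-s} dt`, `M(s) = ∫₀^∞ v^{-s-1} ψ(v) dv`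
(Fubini and the substitutions `u ↦ (1+t²)u`, `u ↦ 1/u`), the Euler integral
`B(s) Γ(s) = √π Γ(s − 1/2)`, for `re s > 1`
`∫₀^∞ y^{s-2} (∑_c φ(c) g_c(y)) dy = (∑_c φ(c) c^{-2s}) B(s) M(s)` with
`(∑_c φ(c) c^{-2s}) ζ(2s) = ζ(2s − 1)` — i.e. the Mellin transform of the part `φ(s) y^{1-s}`,
`φ(s) = √π Γ(s−½) ζ(2s−1) / (Γ(s) ζ(2s))`, of the constant term of `2E(·|ψ)` (Zagier 1981 §1
(13)–(16); Iwaniec, *Spectral methods*, §3.4 and (7.12)) — and the continuity of the horocycle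
average in the height.

## Part 2. The argument

Proof (Zagier's argument run on incomplete Eisenstein series, which avoids continuing
`E(z,s)` itself). Let `ζ(ρ) = 0` with `2 − 2θ < re ρ < 1`, `s₀ = ρ/2`. Choose a bump `ψ ≥ 0`
supported near `1` with `M(s₀) = ∫₀^∞ v^{-s₀-1} ψ(v) dv ≠ 0` (`exists_bump`) and test the rate
hypothesis on `F = incEis ψ`, whose horocycle average is `C(y) = 2ψ(y) + 2∑_c φ(c) g_c(y)`
(both in `HorocycleRHIncompleteEisenstein.lean`), so for `re s > 1`
`∫₀^∞ C(y) y^{s-2} dy = 2M̃(s−1) + 2 L(φ,2s) B(s) M(s)`, `L(φ,2s) ζ(2s) = ζ(2s−1)`,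
`B(s)Γ(s) = √πΓ(s−½)` (Part 1). The rate `C(y) − c₀ = O(y^{θ−ε})` makes
`s ↦ ∫₀^∞ (C − c₀ 1_{(0,Y]}) y^{s-2} dy` holomorphic on `re s > 1 − θ`; clearing the poles,
`(2s−1)ζ(2s)·[…] = 2√πΓ(s+½)/Γ(s) · (2s−2)ζ(2s−1) · M(s)` holds on `re s > 1`, hence on the
half-plane `re s > 1 − θ` by the identity theorem. At `s₀` the left side vanishes with `ζ(ρ)`,
while `Γ(s₀+½)/Γ(s₀) ≠ 0`, `ζ(ρ−1) ≠ 0` (only trivial zeros in `re s ≤ 0`) and `M(s₀) ≠ 0`: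
contradiction.

## References
* D. Zagier, *Eisenstein series and the Riemann zeta function*, in: Automorphic forms,
  representation theory and arithmetic (Bombay 1979), Springer 1981, 275–301, §1 pp. 279–280.
* P. Sarnak, *Asymptotic behavior of periodic orbits of the horocycle flow and Eisenstein series*,
  Comm. Pure Appl. Math. 34 (1981), 719–739, Thm. 1.
* H. Iwaniec, *Spectral methods of automorphic forms*, 2nd ed., AMS GSM 53 (2002), §3.4, §7.1.
-/

noncomputable section

open Complex MeasureTheory Set Filter Asymptotics
open scoped MatrixGroups UpperHalfPlane Topology

namespace Literature.NumberTheory.LFunctions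

variable {ψ : ℝ → ℝ} {a b : ℝ}

/-- `G(u) = ∫_ℝ ψ (1 / (u (1 + t²))) dt`. [folklore] -/
def kernelG (ψ : ℝ → ℝ) (u : ℝ) : ℝ := ∫ t : ℝ, ψ (1 / (u * (1 + t ^ 2)))

/-- `B(s) = ∫_ℝ (1 + t²)^{-s} dt` (`= √π Γ(s-1/2)/Γ(s)` for `re s > 1/2`, `betaR_mul_Gamma`).
[folklore] -/
def betaR (s : ℂ) : ℂ := ∫ t : ℝ, ((1 + t ^ 2 : ℝ) : ℂ) ^ (-s)

/-- `g_c(y) = y G(c² y)` for `y > 0`, `c ≥ 1` (substitute `u = y t`). [folklore] -/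
theorem rowIntegral_eq_mul_kernelG (ψ : ℝ → ℝ) {c : ℕ} (hc : 1 ≤ c) {y : ℝ} (hy : 0 < y) :
    rowIntegral ψ c y = y * kernelG ψ ((c : ℝ) ^ 2 * y) := by
  unfold rowIntegral kernelG rowFun
  have hc0 : (c : ℝ) ≠ 0 := (show (0 : ℝ) < c by exact_mod_cast hc).ne'
  have h := Measure.integral_comp_mul_left (fun t => ψ (1 / ((c : ℝ) ^ 2 * y * (1 + t ^ 2)))) y⁻¹
  rw [inv_inv, abs_of_pos hy, smul_eq_mul] at h
  rw [← h]
  congr 1 with x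
  congr 1
  field_simp
  ring

/-! ### The bump `ψ` under the Mellin transform -/

/-- A continuous `ψ` supported in `[a, b] ⊂ (0, ∞)` has an everywhere convergent Mellin
transform. [folklore] -/
theorem mellinConvergent_bump (hψc : Continuous ψ) (ha : 0 < a) (hψa : ∀ t, ψ t ≠ 0 → a ≤ t)
    (hψb : ∀ t, ψ t ≠ 0 → t ≤ b) (s : ℂ) : MellinConvergent (fun v => (ψ v : ℂ)) s := by
  have hc : Continuous fun v => (ψ v : ℂ) := continuous_ofReal.comp hψc
  refine mellinConvergent_of_isBigO_rpow (a := s.re + 1) (b := s.re - 1)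
    (hc.locallyIntegrable.locallyIntegrableOn _) ?_ (by linarith) ?_ (by linarith)
  · refine (isBigO_zero _ _).congr' ?_ EventuallyEq.rfl
    filter_upwards [eventually_gt_atTop b] with v hv
    have : ψ v = 0 := by by_contra h; exact absurd (hψb v h) (not_le.mpr hv)
    simp [this]
  · refine (isBigO_zero _ _).congr' ?_ EventuallyEq.rfl
    have : Iio a ∈ 𝓝[>] (0 : ℝ) := mem_nhdsWithin_of_mem_nhds (Iio_mem_nhds ha)
    filter_upwards [this] with v hv
    have : ψ v = 0 := by by_contra h; exact absurd (hψa v h) (not_le.mpr hv)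
    simp [this]

/-- … and the Mellin transform `s ↦ ∫₀^∞ v^{s-1} ψ(v) dv` is entire. [folklore] -/
theorem differentiable_mellin_bump (hψc : Continuous ψ) (ha : 0 < a) (hψa : ∀ t, ψ t ≠ 0 → a ≤ t)
    (hψb : ∀ t, ψ t ≠ 0 → t ≤ b) : Differentiable ℂ (mellin fun v => (ψ v : ℂ)) := by
  intro s
  have hc : Continuous fun v => (ψ v : ℂ) := continuous_ofReal.comp hψc
  refine mellin_differentiableAt_of_isBigO_rpow (a := s.re + 1) (b := s.re - 1)
    (hc.locallyIntegrable.locallyIntegrableOn _) ?_ (by linarith) ?_ (by linarith)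
  · refine (isBigO_zero _ _).congr' ?_ EventuallyEq.rfl
    filter_upwards [eventually_gt_atTop b] with v hv
    have : ψ v = 0 := by by_contra h; exact absurd (hψb v h) (not_le.mpr hv)
    simp [this]
  · refine (isBigO_zero _ _).congr' ?_ EventuallyEq.rfl
    have : Iio a ∈ 𝓝[>] (0 : ℝ) := mem_nhdsWithin_of_mem_nhds (Iio_mem_nhds ha)
    filter_upwards [this] with v hv
    have : ψ v = 0 := by by_contra h; exact absurd (hψa v h) (not_le.mpr hv)
    simp [this]

/-- Mellin convergence of `u ↦ ψ(1/(L u))`, `L > 0`, at every `s`. [folklore] -/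
theorem mellinConvergent_bump_inv (hψc : Continuous ψ) (ha : 0 < a) (hψa : ∀ t, ψ t ≠ 0 → a ≤ t)
    (hψb : ∀ t, ψ t ≠ 0 → t ≤ b) {L : ℝ} (hL : 0 < L) (s : ℂ) :
    MellinConvergent (fun u => (ψ (1 / (u * L)) : ℂ)) s := by
  have h1 : MellinConvergent (fun u => (ψ (u ^ (-1 : ℝ)) : ℂ)) s :=
    (MellinConvergent.comp_rpow (f := fun v => (ψ v : ℂ)) (by norm_num)).mpr
      (mellinConvergent_bump hψc ha hψa hψb _)
  have h2 := (MellinConvergent.comp_mul_left (f := fun u => (ψ (u ^ (-1 : ℝ)) : ℂ)) (s := s) hL).mpr h1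
  refine (h2.congr_fun (fun u _ => ?_) measurableSet_Ioi)
  simp only [Real.rpow_neg_one, one_div, mul_comm u L]

/-- `∫₀^∞ u^{s-1} ψ(1/(L u)) du = L^{-s} M(s)`, `M(s) = mellin ψ (-s)`. [folklore] -/
theorem mellin_bump_inv (ψ : ℝ → ℝ) {L : ℝ} (hL : 0 < L) (s : ℂ) :
    mellin (fun u => (ψ (1 / (u * L)) : ℂ)) s = (L : ℂ) ^ (-s) * mellin (fun v => (ψ v : ℂ)) (-s) := by
  have h1 : (fun u : ℝ => (ψ (1 / (u * L)) : ℂ)) = fun u => (fun w : ℝ => (ψ w⁻¹ : ℂ)) (L * u) := by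
    ext u; simp [one_div, mul_comm u L]
  have h2 := mellin_comp_mul_left (fun w : ℝ => (ψ w⁻¹ : ℂ)) s hL
  have h3 := mellin_comp_inv (fun v : ℝ => (ψ v : ℂ)) s
  rw [h1, h2, h3, smul_eq_mul]


/-! ### Fubini: `∫₀^∞ u^{s-1} G(u) du = B(s) M(s)` for `re s > 1/2` -/

/-- The two-variable integrand `(u, t) ↦ u^{s-1} ψ(1/(u(1+t²)))` on `(0,∞) × ℝ`. [folklore] -/
def fubiniIntegrand (ψ : ℝ → ℝ) (s : ℂ) (p : ℝ × ℝ) : ℂ :=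
  (p.1 : ℂ) ^ (s - 1) * (ψ (1 / (p.1 * (1 + p.2 ^ 2))) : ℂ)

/-- Continuity of the two-variable integrand on `(0,∞) × ℝ`. [folklore] -/
theorem continuousOn_fubiniIntegrand (hψc : Continuous ψ) (s : ℂ) :
    ContinuousOn (fubiniIntegrand ψ s) (Ioi 0 ×ˢ univ) := by
  intro p hp
  have hp1 : 0 < p.1 := hp.1
  apply ContinuousAt.continuousWithinAt
  unfold fubiniIntegrand
  apply ContinuousAt.mul
  · exact (continuousAt_ofReal_cpow_const p.1 (s - 1) (Or.inr hp1.ne')).comp continuousAt_fst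
  · refine (continuous_ofReal.comp hψc).continuousAt.comp ?_
    refine ContinuousAt.div continuousAt_const (by fun_prop) ?_
    have : 0 < p.1 * (1 + p.2 ^ 2) := by positivity
    exact this.ne'

/-- Integrability of the two-variable integrand on `(0,∞) × ℝ` for `re s > 1/2`: the `u`-slices
are Mellin integrands of `u ↦ ψ(1/((1+t²)u))`, and `∫₀^∞ |·| du = (1+t²)^{-re s} K` is integrable
in `t`. [folklore] -/
theorem integrable_fubiniIntegrand (hψc : Continuous ψ) (ha : 0 < a) (hψa : ∀ t, ψ t ≠ 0 → a ≤ t)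
    (hψb : ∀ t, ψ t ≠ 0 → t ≤ b) {s : ℂ} (hs : 1 / 2 < s.re) :
    Integrable (fubiniIntegrand ψ s) ((volume.restrict (Ioi 0)).prod volume) := by
  have hmeas : AEStronglyMeasurable (fubiniIntegrand ψ s)
      ((volume.restrict (Ioi 0)).prod volume) := by
    have : (volume.restrict (Ioi (0 : ℝ))).prod (volume : Measure ℝ) =
        (volume.prod volume).restrict (Ioi 0 ×ˢ univ) := by
      rw [← Measure.prod_restrict, Measure.restrict_univ]
    rw [this]
    exact (continuousOn_fubiniIntegrand hψc s).aestronglyMeasurable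
      (measurableSet_Ioi.prod MeasurableSet.univ)
  rw [integrable_prod_iff' hmeas]
  constructor
  · refine Eventually.of_forall fun t => ?_
    have := mellinConvergent_bump_inv hψc ha hψa hψb (L := 1 + t ^ 2) (by positivity) s
    simpa [MellinConvergent, fubiniIntegrand, smul_eq_mul, IntegrableOn] using this
  · set K : ℝ := ∫ v in Ioi (0 : ℝ), v ^ (s.re - 1) * |ψ v⁻¹| with hK
    have hval : ∀ t : ℝ, ∫ u in Ioi (0 : ℝ), ‖fubiniIntegrand ψ s (u, t)‖ =
        (1 + t ^ 2) ^ (-s.re) * K := by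
      intro t
      have hL : 0 < 1 + t ^ 2 := by positivity
      have h1 : ∀ u ∈ Ioi (0 : ℝ), ‖fubiniIntegrand ψ s (u, t)‖ = (1 + t ^ 2) ^ (1 - s.re) *
          ((fun v : ℝ => v ^ (s.re - 1) * |ψ v⁻¹|) ((1 + t ^ 2) * u)) := by
        intro u hu
        have hu' : (0 : ℝ) < u := hu
        simp only [fubiniIntegrand, norm_mul, Complex.norm_real, Real.norm_eq_abs,
          Complex.norm_cpow_eq_rpow_re_of_pos hu', sub_re, one_re]
        rw [Real.mul_rpow hL.le hu'.le, one_div, mul_comm u (1 + t ^ 2)]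
        have e : (1 + t ^ 2) ^ (1 - s.re) * (1 + t ^ 2) ^ (s.re - 1) = 1 := by
          rw [← Real.rpow_add hL]; simp
        calc u ^ (s.re - 1) * |ψ ((1 + t ^ 2) * u)⁻¹|
            = ((1 + t ^ 2) ^ (1 - s.re) * (1 + t ^ 2) ^ (s.re - 1)) *
                (u ^ (s.re - 1) * |ψ ((1 + t ^ 2) * u)⁻¹|) := by rw [e, one_mul]
          _ = _ := by ring
      rw [setIntegral_congr_fun measurableSet_Ioi h1, integral_const_mul,
        integral_comp_mul_left_Ioi (fun v : ℝ => v ^ (s.re - 1) * |ψ v⁻¹|) 0 hL]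
      simp only [mul_zero, smul_eq_mul, ← hK]
      rw [show -s.re = (1 - s.re) - 1 by ring, Real.rpow_sub_one hL.ne']
      ring
    have hfun : (fun t : ℝ => ∫ u in Ioi (0 : ℝ), ‖fubiniIntegrand ψ s (u, t)‖) =
        fun t : ℝ => (1 + t ^ 2) ^ (-s.re) * K := funext hval
    rw [hfun]
    have hint := integrable_rpow_neg_one_add_norm_sq (E := ℝ) (μ := volume) (r := 2 * s.re)
      (by simp; linarith)
    have hfun2 : (fun t : ℝ => (1 + ‖t‖ ^ 2) ^ (-(2 * s.re) / 2)) =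
        fun t : ℝ => (1 + t ^ 2) ^ (-s.re) := by
      ext t
      rw [Real.norm_eq_abs, sq_abs]
      congr 1
      ring
    rw [hfun2] at hint
    exact hint.mul_const K

/-- **`∫₀^∞ u^{s-1} G(u) du = B(s) M(s)`** for `re s > 1/2` (and the Mellin integral converges):
Fubini, then `u ↦ (1+t²) u` and `u ↦ 1/u` in the inner integral. [folklore] -/
theorem hasMellin_kernelG (hψc : Continuous ψ) (ha : 0 < a) (hψa : ∀ t, ψ t ≠ 0 → a ≤ t)
    (hψb : ∀ t, ψ t ≠ 0 → t ≤ b) {s : ℂ} (hs : 1 / 2 < s.re) :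
    MellinConvergent (fun u => (kernelG ψ u : ℂ)) s ∧
      mellin (fun u => (kernelG ψ u : ℂ)) s = betaR s * mellin (fun v => (ψ v : ℂ)) (-s) := by
  have hint := integrable_fubiniIntegrand hψc ha hψa hψb hs
  have hslice : ∀ u : ℝ, ∫ t, fubiniIntegrand ψ s (u, t) =
      (u : ℂ) ^ (s - 1) • ((kernelG ψ u : ℝ) : ℂ) := by
    intro u
    simp only [fubiniIntegrand, kernelG, smul_eq_mul]
    rw [integral_const_mul, integral_complex_ofReal]
  constructor
  · have h := hint.integral_prod_left
    have hfun : (fun u : ℝ => ∫ t, fubiniIntegrand ψ s (u, t)) =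
        fun u : ℝ => (u : ℂ) ^ (s - 1) • ((kernelG ψ u : ℝ) : ℂ) := funext hslice
    rw [hfun] at h
    exact h
  · have h2 : ∀ t : ℝ, ∫ u in Ioi (0 : ℝ), fubiniIntegrand ψ s (u, t) =
        ((1 + t ^ 2 : ℝ) : ℂ) ^ (-s) * mellin (fun v => (ψ v : ℂ)) (-s) := by
      intro t
      have := mellin_bump_inv ψ (L := 1 + t ^ 2) (by positivity) s
      simpa [mellin, fubiniIntegrand, smul_eq_mul] using this
    calc mellin (fun u => (kernelG ψ u : ℂ)) s
        = ∫ u in Ioi (0 : ℝ), ∫ t, fubiniIntegrand ψ s (u, t) := by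
          rw [mellin]; exact setIntegral_congr_fun measurableSet_Ioi (fun u _ => (hslice u).symm)
      _ = ∫ t, ∫ u in Ioi (0 : ℝ), fubiniIntegrand ψ s (u, t) := integral_integral_swap hint
      _ = ∫ t : ℝ, ((1 + t ^ 2 : ℝ) : ℂ) ^ (-s) * mellin (fun v => (ψ v : ℂ)) (-s) := by
          exact integral_congr_ae (Eventually.of_forall h2)
      _ = betaR s * mellin (fun v => (ψ v : ℂ)) (-s) := by rw [integral_mul_const]; rfl


/-! ### The `c`-sum: `∫₀^∞ y^{s-2} ∑_c φ(c) g_c(y) dy = (∑_c φ(c) c^{-2s}) B(s) M(s)`, `re s > 1` -/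

/-- Mellin transform of one row: `∫₀^∞ y^{s-2} g_c(y) dy = (c²)^{-s} B(s) M(s)` (`c ≥ 1`,
`re s > 1/2`), with convergence; from `g_c(y) = y G(c² y)` and `hasMellin_kernelG`. [folklore] -/
theorem hasMellin_rowIntegral (hψc : Continuous ψ) (ha : 0 < a) (hψa : ∀ t, ψ t ≠ 0 → a ≤ t)
    (hψb : ∀ t, ψ t ≠ 0 → t ≤ b) {s : ℂ} (hs : 1 / 2 < s.re) {c : ℕ} (hc : 1 ≤ c) :
    MellinConvergent (fun y => (rowIntegral ψ c y : ℂ)) (s - 1) ∧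
      mellin (fun y => (rowIntegral ψ c y : ℂ)) (s - 1) =
        (((c : ℝ) ^ 2 : ℝ) : ℂ) ^ (-s) * (betaR s * mellin (fun v => (ψ v : ℂ)) (-s)) := by
  obtain ⟨hG1, hG2⟩ := hasMellin_kernelG hψc ha hψa hψb hs
  have hc2 : (0 : ℝ) < (c : ℝ) ^ 2 := by positivity
  set Gc : ℝ → ℂ := fun y => ((kernelG ψ ((c : ℝ) ^ 2 * y) : ℝ) : ℂ) with hGc
  have heq : EqOn (fun y : ℝ => (y : ℂ) ^ (1 : ℂ) • Gc y) (fun y : ℝ => (rowIntegral ψ c y : ℂ))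
      (Ioi 0) := by
    intro y hy
    simp only [hGc, rowIntegral_eq_mul_kernelG ψ hc hy, cpow_one, smul_eq_mul, Complex.ofReal_mul]
  have hconvG : MellinConvergent Gc s :=
    (MellinConvergent.comp_mul_left (f := fun u => ((kernelG ψ u : ℝ) : ℂ)) (s := s) hc2).mpr hG1
  have hvalG : mellin Gc s = (((c : ℝ) ^ 2 : ℝ) : ℂ) ^ (-s) * (betaR s * mellin (fun v => (ψ v : ℂ)) (-s)) := by
    rw [← hG2, ← smul_eq_mul]
    exact mellin_comp_mul_left (fun u => ((kernelG ψ u : ℝ) : ℂ)) s hc2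
  -- Mellin convergence and the Mellin transform only depend on the values on `(0, ∞)`
  have hmc : ∀ {f g : ℝ → ℂ}, MellinConvergent f (s - 1) → EqOn f g (Ioi 0) →
      MellinConvergent g (s - 1) := fun hf h =>
    IntegrableOn.congr_fun hf (fun t ht => by simp [h ht]) measurableSet_Ioi
  have hmv : ∀ {f g : ℝ → ℂ}, EqOn f g (Ioi 0) → mellin f (s - 1) = mellin g (s - 1) := fun h =>
    setIntegral_congr_fun measurableSet_Ioi fun t ht => by simp [h ht]
  constructor
  · refine hmc ?_ heq
    rw [MellinConvergent.cpow_smul, sub_add_cancel]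
    exact hconvG
  · rw [← hmv heq, mellin_cpow_smul, sub_add_cancel, hvalG]

/-- Real substitution: `∫₀^∞ y^{σ-1} G(c² y) dy = (c²)^{-σ} ∫₀^∞ u^{σ-1} G(u) du`. [folklore] -/
theorem integral_rpow_mul_kernelG_comp (ψ : ℝ → ℝ) (σ : ℝ) {L : ℝ} (hL : 0 < L) :
    ∫ y in Ioi (0 : ℝ), y ^ (σ - 1) * kernelG ψ (L * y) =
      L ^ (-σ) * ∫ u in Ioi (0 : ℝ), u ^ (σ - 1) * kernelG ψ u := by
  have h1 : ∀ y ∈ Ioi (0 : ℝ), y ^ (σ - 1) * kernelG ψ (L * y) =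
      L ^ (1 - σ) * ((fun u : ℝ => u ^ (σ - 1) * kernelG ψ u) (L * y)) := by
    intro y hy
    have hy' : (0 : ℝ) < y := hy
    simp only [Real.mul_rpow hL.le hy'.le]
    have e : L ^ (1 - σ) * L ^ (σ - 1) = 1 := by rw [← Real.rpow_add hL]; simp
    calc y ^ (σ - 1) * kernelG ψ (L * y)
        = (L ^ (1 - σ) * L ^ (σ - 1)) * (y ^ (σ - 1) * kernelG ψ (L * y)) := by rw [e, one_mul]
      _ = _ := by ring
  rw [setIntegral_congr_fun measurableSet_Ioi h1, integral_const_mul,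
    integral_comp_mul_left_Ioi (fun u : ℝ => u ^ (σ - 1) * kernelG ψ u) 0 hL]
  simp only [mul_zero, smul_eq_mul]
  rw [show -σ = (1 - σ) - 1 by ring, Real.rpow_sub_one hL.ne']
  ring

/-- **The `c`-sum under the Mellin transform** (`re s > 1`, `ψ ≥ 0`):
`∑_c φ(c) (c²)^{-s} B(s) M(s)` sums to `∫₀^∞ y^{s-2} (∑_c φ(c) g_c(y)) dy`
(term-wise integration, justified by `∑_c φ(c) c^{-2 re s} < ∞`). This is the Mellin transform of
the part `φ(s) y^{1-s} ↔ ∑ φ(c) g_c` of the constant term of `2E(·|ψ)`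
(Zagier 1981 §1; Iwaniec §3.4). [cite: Zagier1981, §1 pp. 278–280] -/
theorem hasSum_integral_rowSum (hψc : Continuous ψ) (ha : 0 < a) (hψa : ∀ t, ψ t ≠ 0 → a ≤ t)
    (hψb : ∀ t, ψ t ≠ 0 → t ≤ b) (hψ0 : ∀ t, 0 ≤ ψ t) {s : ℂ} (hs : 1 < s.re) :
    HasSum (fun c : ℕ => (c.totient : ℂ) * ((((c : ℝ) ^ 2 : ℝ) : ℂ) ^ (-s) *
        (betaR s * mellin (fun v => (ψ v : ℂ)) (-s))))
      (∫ y in Ioi (0 : ℝ), (y : ℂ) ^ (s - 2) *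
        ((∑' c : ℕ, (c.totient : ℝ) * rowIntegral ψ c y : ℝ) : ℂ)) := by
  set BM : ℂ := betaR s * mellin (fun v => (ψ v : ℂ)) (-s) with hBM
  set F : ℕ → ℝ → ℂ := fun c y => (c.totient : ℂ) * ((y : ℂ) ^ (s - 2) * (rowIntegral ψ c y : ℂ))
    with hF
  have hs' : 1 / 2 < s.re := by linarith
  have e2 : s - 1 - 1 = s - 2 := by ring
  -- (i) integrability of each term
  have hFint : ∀ c, Integrable (F c) (volume.restrict (Ioi 0)) := by
    intro c
    rcases Nat.eq_zero_or_pos c with rfl | hc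
    · simp only [hF, Nat.totient_zero, Nat.cast_zero, zero_mul]
      exact integrable_zero _ _ _
    · have := (hasMellin_rowIntegral hψc ha hψa hψb hs' hc).1
      simp only [MellinConvergent, e2, smul_eq_mul, IntegrableOn] at this
      exact this.const_mul _
  -- (ii) the values
  have hFval : ∀ c, ∫ y in Ioi (0 : ℝ), F c y = (c.totient : ℂ) * ((((c : ℝ) ^ 2 : ℝ) : ℂ) ^ (-s) * BM) := by
    intro c
    rcases Nat.eq_zero_or_pos c with rfl | hc
    · simp [hF]
    · have := (hasMellin_rowIntegral hψc ha hψa hψb hs' hc).2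
      simp only [hF]
      rw [integral_const_mul, ← this]
      simp only [mellin, e2, smul_eq_mul]
  -- (iii) the norms
  set K : ℝ := ∫ u in Ioi (0 : ℝ), u ^ (s.re - 1) * kernelG ψ u with hK
  have hG0 : ∀ u, 0 ≤ kernelG ψ u := fun u => integral_nonneg fun t => hψ0 _
  have hrow0 : ∀ c y, 0 ≤ rowIntegral ψ c y := fun c y => integral_nonneg fun t => hψ0 _
  have hFnorm : ∀ c, ∫ y in Ioi (0 : ℝ), ‖F c y‖ =
      (c.totient : ℝ) * (((c : ℝ) ^ 2) ^ (-s.re) * K) := by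
    intro c
    rcases Nat.eq_zero_or_pos c with rfl | hc
    · simp [hF]
    · have hc2 : (0 : ℝ) < (c : ℝ) ^ 2 := by positivity
      have h1 : ∀ y ∈ Ioi (0 : ℝ), ‖F c y‖ =
          (c.totient : ℝ) * (y ^ (s.re - 1) * kernelG ψ ((c : ℝ) ^ 2 * y)) := by
        intro y hy
        have hy' : (0 : ℝ) < y := hy
        simp only [hF, norm_mul, Complex.norm_natCast, Complex.norm_real, Real.norm_eq_abs,
          Complex.norm_cpow_eq_rpow_re_of_pos hy', sub_re, re_ofNat, abs_of_nonneg (hrow0 c y)]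
        rw [rowIntegral_eq_mul_kernelG ψ hc hy', ← mul_assoc (y ^ (s.re - 2)),
          show s.re - 1 = (s.re - 2) + 1 by ring, Real.rpow_add_one hy'.ne']
      rw [setIntegral_congr_fun measurableSet_Ioi h1, integral_const_mul,
        integral_rpow_mul_kernelG_comp ψ s.re hc2]
  -- (iv) summability of the norms
  have hsum : Summable fun c => ∫ y in Ioi (0 : ℝ), ‖F c y‖ := by
    simp_rw [hFnorm]
    refine Summable.of_norm_bounded (g := fun c : ℕ => |K| * (c : ℝ) ^ (1 - 2 * s.re)) ?_ ?_
    · exact (Real.summable_nat_rpow.mpr (by linarith)).mul_left _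
    · intro c
      rcases Nat.eq_zero_or_pos c with rfl | hc
      · simp [Real.zero_rpow (by linarith : (1 : ℝ) - 2 * s.re ≠ 0)]
      · have hc' : (0 : ℝ) < c := by exact_mod_cast hc
        have hφ : (c.totient : ℝ) ≤ c := by exact_mod_cast Nat.totient_le c
        have hpow : ((c : ℝ) ^ 2) ^ (-s.re) = (c : ℝ) ^ (-(2 * s.re)) := by
          rw [show ((c : ℝ) ^ 2) = (c : ℝ) ^ ((2 : ℕ) : ℝ) from (Real.rpow_natCast _ 2).symm,
            ← Real.rpow_mul hc'.le]
          congr 1; push_cast; ring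
        have hpos : 0 ≤ ((c : ℝ) ^ 2) ^ (-s.re) := Real.rpow_nonneg (by positivity) _
        rw [Real.norm_eq_abs, abs_mul, abs_mul, abs_of_nonneg (Nat.cast_nonneg _),
          abs_of_nonneg hpos, hpow]
        calc (c.totient : ℝ) * ((c : ℝ) ^ (-(2 * s.re)) * |K|)
            ≤ c * ((c : ℝ) ^ (-(2 * s.re)) * |K|) := by gcongr
          _ = |K| * (c : ℝ) ^ (1 - 2 * s.re) := by
            rw [show (1 : ℝ) - 2 * s.re = 1 + (-(2 * s.re)) by ring, Real.rpow_add hc',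
              Real.rpow_one]
            ring
  -- (v) assemble
  have hmain := hasSum_integral_of_summable_integral_norm hFint hsum
  have lhs : (fun c => ∫ y in Ioi (0 : ℝ), F c y) =
      fun c : ℕ => (c.totient : ℂ) * ((((c : ℝ) ^ 2 : ℝ) : ℂ) ^ (-s) * BM) := funext hFval
  have rhs : ∀ y : ℝ, ∑' c, F c y =
      (y : ℂ) ^ (s - 2) * ((∑' c : ℕ, (c.totient : ℝ) * rowIntegral ψ c y : ℝ) : ℂ) := by
    intro y
    rw [Complex.ofReal_tsum]
    push_cast
    rw [← tsum_mul_left]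
    refine tsum_congr fun c => ?_
    simp only [hF]
    ring
  rw [lhs] at hmain
  have rhs' : (fun y : ℝ => ∑' c, F c y) =
      fun y : ℝ => (y : ℂ) ^ (s - 2) * ((∑' c : ℕ, (c.totient : ℝ) * rowIntegral ψ c y : ℝ) : ℂ) :=
    funext rhs
  rw [rhs'] at hmain
  exact hmain


/-! ### The Euler integral `B(s) Γ(s) = √π Γ(s - 1/2)` -/

/-- The Euler integrand `(x, t) ↦ x^{s-1} e^{-(1+t²)x}` on `(0,∞) × ℝ`. [folklore] -/
def eulerIntegrand (s : ℂ) (p : ℝ × ℝ) : ℂ :=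
  (p.1 : ℂ) ^ (s - 1) * Complex.exp (-(((1 + p.2 ^ 2 : ℝ) : ℂ) * p.1))

/-- `(1/r)^s = r^{-s}` for `r > 0`. [folklore] -/
theorem one_div_ofReal_cpow {r : ℝ} (hr : 0 < r) (s : ℂ) : (1 / (r : ℂ)) ^ s = (r : ℂ) ^ (-s) := by
  have harg : (r : ℂ).arg ≠ Real.pi := by
    rw [Complex.arg_ofReal_of_nonneg hr.le]
    exact Real.pi_ne_zero.symm
  rw [one_div, Complex.inv_cpow _ _ harg, cpow_neg]

/-- `x`-slices of the Euler integrand: `∫₀^∞ x^{s-1} e^{-(1+t²)x} dx = (1+t²)^{-s} Γ(s)`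
(`re s > 0`). [folklore] -/
theorem integral_eulerIntegrand_fst {s : ℂ} (hs : 0 < s.re) (t : ℝ) :
    ∫ x in Ioi (0 : ℝ), eulerIntegrand s (x, t) = ((1 + t ^ 2 : ℝ) : ℂ) ^ (-s) * Gamma s := by
  have hL : 0 < 1 + t ^ 2 := by positivity
  have := Complex.integral_cpow_mul_exp_neg_mul_Ioi hs hL
  rw [one_div_ofReal_cpow hL] at this
  simpa [eulerIntegrand] using this

/-- `t`-slices: `∫_ℝ x^{s-1} e^{-(1+t²)x} dt = x^{s-1} e^{-x} √(π/x)` (Gaussian integral; for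
`x ≤ 0` both sides are Mathlib's junk value `0`). [folklore] -/
theorem integral_eulerIntegrand_snd (s : ℂ) (x : ℝ) :
    ∫ t : ℝ, eulerIntegrand s (x, t) =
      (x : ℂ) ^ (s - 1) * Complex.exp (-(x : ℂ)) * ((Real.sqrt (Real.pi / x) : ℝ) : ℂ) := by
  have h1 : ∀ t : ℝ, eulerIntegrand s (x, t) =
      (x : ℂ) ^ (s - 1) * Complex.exp (-(x : ℂ)) * ((Real.exp (-x * t ^ 2) : ℝ) : ℂ) := by
    intro t
    simp only [eulerIntegrand, Complex.ofReal_exp]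
    rw [mul_assoc, ← Complex.exp_add]
    congr 2
    push_cast
    ring
  simp_rw [h1]
  rw [integral_const_mul, integral_complex_ofReal, integral_gaussian]

/-- Integrability of the Euler integrand on `(0,∞) × ℝ` for `re s > 1/2`. [folklore] -/
theorem integrable_eulerIntegrand {s : ℂ} (hs : 1 / 2 < s.re) :
    Integrable (eulerIntegrand s) ((volume.restrict (Ioi 0)).prod volume) := by
  have hs0 : 0 < s.re := by linarith
  have hcont : ContinuousOn (eulerIntegrand s) (Ioi 0 ×ˢ univ) := by
    intro p hp
    have hp1 : 0 < p.1 := hp.1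
    apply ContinuousAt.continuousWithinAt
    unfold eulerIntegrand
    apply ContinuousAt.mul
    · exact (continuousAt_ofReal_cpow_const p.1 (s - 1) (Or.inr hp1.ne')).comp continuousAt_fst
    · exact (Complex.continuous_exp.comp (by fun_prop)).continuousAt
  have hslice : ∀ t : ℝ, ContinuousOn (fun x : ℝ => eulerIntegrand s (x, t)) (Ioi 0) := by
    intro t x hx
    apply ContinuousAt.continuousWithinAt
    unfold eulerIntegrand
    exact (continuousAt_ofReal_cpow_const x (s - 1) (Or.inr (ne_of_gt hx))).mul
      (Complex.continuous_exp.comp (by fun_prop)).continuousAt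
  have hmeas : AEStronglyMeasurable (eulerIntegrand s) ((volume.restrict (Ioi 0)).prod volume) := by
    have : (volume.restrict (Ioi (0 : ℝ))).prod (volume : Measure ℝ) =
        (volume.prod volume).restrict (Ioi 0 ×ˢ univ) := by
      rw [← Measure.prod_restrict, Measure.restrict_univ]
    rw [this]
    exact hcont.aestronglyMeasurable (measurableSet_Ioi.prod MeasurableSet.univ)
  have hnorm : ∀ t : ℝ, ∀ x ∈ Ioi (0 : ℝ), ‖eulerIntegrand s (x, t)‖ =
      x ^ (s.re - 1) * Real.exp (-((1 + t ^ 2) * x)) := by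
    intro t x hx
    have hx' : (0 : ℝ) < x := hx
    rw [eulerIntegrand, norm_mul, Complex.norm_cpow_eq_rpow_re_of_pos hx', Complex.norm_exp,
      sub_re, one_re, neg_re, Complex.re_ofReal_mul, Complex.ofReal_re]
  have hval : ∀ t : ℝ, ∫ x in Ioi (0 : ℝ), ‖eulerIntegrand s (x, t)‖ =
      (1 + t ^ 2) ^ (-s.re) * Real.Gamma s.re := by
    intro t
    have hL : 0 < 1 + t ^ 2 := by positivity
    rw [setIntegral_congr_fun measurableSet_Ioi (hnorm t),
      Real.integral_rpow_mul_exp_neg_mul_Ioi hs0 hL, one_div, Real.inv_rpow hL.le,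
      Real.rpow_neg hL.le]
  rw [integrable_prod_iff' hmeas]
  constructor
  · refine Eventually.of_forall fun t => ?_
    have hL : 0 < 1 + t ^ 2 := by positivity
    have hreal := integrableOn_rpow_mul_exp_neg_mul_rpow (s := s.re - 1) (p := 1) (by linarith)
      le_rfl hL
    have hreal' : IntegrableOn (fun x : ℝ => x ^ (s.re - 1) * Real.exp (-((1 + t ^ 2) * x)))
        (Ioi 0) :=
      hreal.congr_fun (fun x _ => by simp only [Real.rpow_one, neg_mul]) measurableSet_Ioi
    refine Integrable.mono' hreal' ((hslice t).aestronglyMeasurable measurableSet_Ioi) ?_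
    exact (ae_restrict_mem measurableSet_Ioi).mono fun x hx => (hnorm t x hx).le
  · have hfun : (fun t : ℝ => ∫ x in Ioi (0 : ℝ), ‖eulerIntegrand s (x, t)‖) =
        fun t : ℝ => (1 + t ^ 2) ^ (-s.re) * Real.Gamma s.re := funext hval
    rw [hfun]
    have hint := integrable_rpow_neg_one_add_norm_sq (E := ℝ) (μ := volume) (r := 2 * s.re)
      (by simp; linarith)
    have hfun2 : (fun t : ℝ => (1 + ‖t‖ ^ 2) ^ (-(2 * s.re) / 2)) =
        fun t : ℝ => (1 + t ^ 2) ^ (-s.re) := by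
      ext t
      rw [Real.norm_eq_abs, sq_abs]
      congr 1
      ring
    rw [hfun2] at hint
    exact hint.mul_const _

/-- **Euler's integral** `B(s) Γ(s) = √π Γ(s − 1/2)` for `re s > 1/2`, i.e.
`∫_ℝ (1+t²)^{-s} dt = √π Γ(s-1/2)/Γ(s)`: write `(1+t²)^{-s} Γ(s) = ∫₀^∞ x^{s-1} e^{-(1+t²)x} dx`,
swap the integrals, and use the Gaussian integral `∫ e^{-xt²} dt = √(π/x)`. [folklore] -/
theorem betaR_mul_Gamma {s : ℂ} (hs : 1 / 2 < s.re) :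
    betaR s * Gamma s = ((Real.sqrt Real.pi : ℝ) : ℂ) * Gamma (s - 1 / 2) := by
  have hint := integrable_eulerIntegrand hs
  have hs0 : 0 < s.re := by linarith
  have hs1 : 0 < (s - 1 / 2).re := by norm_num [sub_re]; linarith
  calc betaR s * Gamma s
      = ∫ t : ℝ, ((1 + t ^ 2 : ℝ) : ℂ) ^ (-s) * Gamma s := by rw [betaR, integral_mul_const]
    _ = ∫ t : ℝ, ∫ x in Ioi (0 : ℝ), eulerIntegrand s (x, t) := by
        simp_rw [integral_eulerIntegrand_fst hs0]
    _ = ∫ x in Ioi (0 : ℝ), ∫ t : ℝ, eulerIntegrand s (x, t) :=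
        (integral_integral_swap (f := fun x t => eulerIntegrand s (x, t)) hint).symm
    _ = ∫ x in Ioi (0 : ℝ), (x : ℂ) ^ (s - 1) * Complex.exp (-(x : ℂ)) *
          ((Real.sqrt (Real.pi / x) : ℝ) : ℂ) :=
        setIntegral_congr_fun measurableSet_Ioi fun x _ => integral_eulerIntegrand_snd s x
    _ = ∫ x in Ioi (0 : ℝ), ((Real.sqrt Real.pi : ℝ) : ℂ) *
          (((Real.exp (-x) : ℝ) : ℂ) * (x : ℂ) ^ (s - 1 / 2 - 1)) := by
        refine setIntegral_congr_fun measurableSet_Ioi fun x hx => ?_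
        have hx' : (0 : ℝ) < x := hx
        have hx0 : (x : ℂ) ≠ 0 := ofReal_ne_zero.mpr hx'.ne'
        rw [Real.sqrt_div' _ hx'.le, Real.sqrt_eq_rpow x, Complex.ofReal_div,
          Complex.ofReal_cpow hx'.le, Complex.ofReal_exp, Complex.ofReal_neg,
          show s - 1 / 2 - 1 = (s - 1) - (1 / 2 : ℂ) by ring, Complex.cpow_sub (s - 1) (1 / 2 : ℂ) hx0]
        push_cast
        ring
    _ = ((Real.sqrt Real.pi : ℝ) : ℂ) * Gamma (s - 1 / 2) := by
        rw [integral_const_mul, Complex.Gamma_eq_integral hs1, Complex.GammaIntegral]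


/-! ### Continuity of the horocycle average in the height -/

/-- The horocycle average `y ↦ ∫₀¹ incEis ψ (x+iy) dx` is continuous on `(0, ∞)` (dominated
convergence: `incEis ψ` is continuous on `{im > 0}`, hence bounded on compact boxes). [folklore] -/
theorem continuousOn_horocycleAverage (ha : 0 < a) (hψa : ∀ t, ψ t ≠ 0 → a ≤ t)
    (hψ : ContDiff ℝ (⊤ : ℕ∞) ψ) :
    ContinuousOn (fun y : ℝ => ∫ x in (0 : ℝ)..1, incEis ψ (↑x + ↑y * I)) (Ioi 0) := by
  intro y₀ hy₀
  have hy₀' : (0 : ℝ) < y₀ := hy₀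
  apply ContinuousAt.continuousWithinAt
  have hopen : IsOpen {z : ℂ | 0 < z.im} := isOpen_lt continuous_const Complex.continuous_im
  have hcont : ContinuousOn (incEis ψ) {z : ℂ | 0 < z.im} :=
    (contDiffOn_incEis ha hψa hψ).continuousOn
  set Kbox : Set ℂ := (Icc (-1 : ℝ) 2) ×ℂ (Icc (y₀ / 2) (2 * y₀)) with hKbox
  have hK : IsCompact Kbox := isCompact_Icc.reProdIm isCompact_Icc
  have hKsub : Kbox ⊆ {z : ℂ | 0 < z.im} := fun z hz => by
    have := (Complex.mem_reProdIm.mp hz).2.1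
    simp only [mem_setOf_eq]; linarith
  obtain ⟨M, hM⟩ := hK.exists_bound_of_continuousOn (hcont.mono hKsub)
  refine intervalIntegral.continuousAt_of_dominated_interval (bound := fun _ => M) ?_ ?_
    intervalIntegrable_const ?_
  · filter_upwards [Ioi_mem_nhds hy₀'] with y hy
    refine Continuous.aestronglyMeasurable ?_
    exact hcont.comp_continuous (f := fun x : ℝ => (↑x + ↑y * I)) (by fun_prop)
      (fun x => by simpa using hy)
  · have : Ioo (y₀ / 2) (2 * y₀) ∈ 𝓝 y₀ := Ioo_mem_nhds (by linarith) (by linarith)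
    filter_upwards [this] with y hy
    refine Eventually.of_forall fun x hx => hM _ ?_
    rw [Set.uIoc_of_le zero_le_one] at hx
    refine Complex.mem_reProdIm.mpr ⟨?_, ?_⟩
    · simp only [add_re, ofReal_re, mul_re, I_re, mul_zero, ofReal_im, I_im, mul_one, sub_self,
        add_zero, mem_Icc]
      exact ⟨by linarith [hx.1], by linarith [hx.2]⟩
    · simp only [add_im, ofReal_im, mul_im, ofReal_re, I_im, mul_one, I_re, mul_zero, add_zero,
        zero_add, mem_Icc]
      exact ⟨by linarith [hy.1], by linarith [hy.2]⟩
  · refine Eventually.of_forall fun x _ => ?_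
    have hmem : {z : ℂ | 0 < z.im} ∈ 𝓝 ((x : ℂ) + (y₀ : ℂ) * I) := hopen.mem_nhds (by simpa using hy₀')
    exact (hcont.continuousAt hmem).comp (f := fun y : ℝ => (↑x + ↑y * I)) (by fun_prop)


/-! ### The Dirichlet series `∑ φ(c) c^{-w} = ζ(w-1)/ζ(w)` -/

/-- `L(φ, w) ζ(w) = ζ(w − 1)` for `re w > 2` (`φ * 1 = id`, Mathlib `Nat.sum_totient`, and
`LSeries_convolution`). [folklore] -/
theorem LSeries_totient_mul_zeta {w : ℂ} (hw : 2 < w.re) :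
    LSeries (fun n => (n.totient : ℂ)) w * riemannZeta w = riemannZeta (w - 1) := by
  have h1 : LSeries.abscissaOfAbsConv (fun n => (n.totient : ℂ)) < w.re := by
    refine lt_of_le_of_lt
      (LSeries.abscissaOfAbsConv_le_of_le_const_mul_rpow (x := 1) ⟨1, fun n _ => ?_⟩) ?_
    · simp only [Complex.norm_natCast, Real.rpow_one, one_mul]
      exact_mod_cast Nat.totient_le n
    · have : ((1 : ℝ) : EReal) + 1 = ((2 : ℝ) : EReal) := by
        rw [← EReal.coe_one, ← EReal.coe_add]; norm_num
      rw [this]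
      exact EReal.coe_lt_coe_iff.mpr hw
  have h2 : LSeries.abscissaOfAbsConv 1 < w.re := by
    rw [LSeries.abscissaOfAbsConv_one]
    exact_mod_cast (by linarith : (1 : ℝ) < w.re)
  have hconv : LSeries.convolution (fun n => (n.totient : ℂ)) 1 = fun n : ℕ => (n : ℂ) := by
    ext n
    rw [LSeries.convolution_def]
    simp only [Pi.one_apply, mul_one]
    rw [Nat.sum_divisorsAntidiagonal (f := fun i _ => ((i.totient : ℕ) : ℂ))]
    exact_mod_cast Nat.sum_totient n
  have h3 := LSeries_convolution h1 h2
  rw [hconv, LSeries_one_eq_riemannZeta (by linarith)] at h3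
  rw [← h3]
  have h4 : LSeries (fun n : ℕ => (n : ℂ)) w = LSeries 1 (w - 1) := by
    unfold LSeries
    refine tsum_congr fun n => ?_
    rcases Nat.eq_zero_or_pos n with rfl | hn
    · simp [LSeries.term]
    · rw [LSeries.term_of_ne_zero hn.ne', LSeries.term_of_ne_zero hn.ne', Pi.one_apply,
        Complex.cpow_sub _ _ (by exact_mod_cast hn.ne'), cpow_one]
      field_simp
  rw [h4, LSeries_one_eq_riemannZeta]
  simp only [sub_re, one_re]; linarith

/-- `(c²)^{-s} = c^{-2s}` for natural `c`. [folklore] -/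
theorem natCast_sq_cpow_neg (c : ℕ) (s : ℂ) : ((c : ℂ) ^ 2) ^ (-s) = (c : ℂ) ^ (-(2 * s)) := by
  have him : (Complex.log (c : ℂ) * 2).im = 0 := by
    rw [← Complex.natCast_log, show ((Real.log c : ℝ) : ℂ) * 2 = ((Real.log c * 2 : ℝ) : ℂ) by
      push_cast; ring, Complex.ofReal_im]
  rw [show -(2 * s) = (2 : ℂ) * (-s) by ring, Complex.cpow_mul, Complex.cpow_two]
  · rw [him]; exact neg_lt_zero.mpr Real.pi_pos
  · rw [him]; exact Real.pi_pos.le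

/-- The coefficient sum of `hasSum_integral_rowSum` is `L(φ, 2s)`:
`(∑_c φ(c) (c²)^{-s}) ζ(2s) = ζ(2s − 1)` for `re s > 1`. [folklore] -/
theorem totientSum_mul_zeta {s : ℂ} (hs : 1 < s.re) :
    (∑' c : ℕ, (c.totient : ℂ) * ((((c : ℝ) ^ 2 : ℝ) : ℂ) ^ (-s))) * riemannZeta (2 * s) =
      riemannZeta (2 * s - 1) := by
  have hterm : ∀ c : ℕ, (c.totient : ℂ) * ((((c : ℝ) ^ 2 : ℝ) : ℂ) ^ (-s)) =
      LSeries.term (fun n => (n.totient : ℂ)) (2 * s) c := by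
    intro c
    rcases Nat.eq_zero_or_pos c with rfl | hc
    · simp [LSeries.term]
    · rw [LSeries.term_of_ne_zero hc.ne']
      push_cast
      rw [natCast_sq_cpow_neg c s, cpow_neg, div_eq_mul_inv]
  rw [show (∑' c : ℕ, (c.totient : ℂ) * ((((c : ℝ) ^ 2 : ℝ) : ℂ) ^ (-s))) =
    LSeries (fun n => (n.totient : ℂ)) (2 * s) from tsum_congr hterm,
    LSeries_totient_mul_zeta (by simp; linarith)]

/-! ### `(w − 1) ζ(w)` as an entire function -/

/-- `(w − 1) ζ(w)` with the removable singularity at `w = 1` filled in by the residue `1`.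
[folklore] -/
def zetaReg : ℂ → ℂ := Function.update (fun w => (w - 1) * riemannZeta w) 1 1

/-- Off `w = 1`, `zetaReg w = (w − 1) ζ(w)`. [folklore] -/
theorem zetaReg_of_ne_one {w : ℂ} (hw : w ≠ 1) : zetaReg w = (w - 1) * riemannZeta w :=
  Function.update_of_ne hw _ _

/-- `zetaReg` is entire (Riemann's removable singularity theorem and
Mathlib's `riemannZeta_residue_one`). [folklore] -/
theorem differentiable_zetaReg : Differentiable ℂ zetaReg := by
  have hoff : ∀ w : ℂ, w ≠ 1 → DifferentiableAt ℂ zetaReg w := by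
    intro w hw
    have heq : zetaReg =ᶠ[𝓝 w] fun w => (w - 1) * riemannZeta w := by
      filter_upwards [isOpen_ne.mem_nhds hw] with z hz
      exact zetaReg_of_ne_one hz
    refine DifferentiableAt.congr_of_eventuallyEq ?_ heq
    exact (differentiableAt_id.sub_const 1).mul (differentiableAt_riemannZeta hw)
  intro w
  rcases eq_or_ne w 1 with rfl | hw
  · refine (Complex.analyticAt_of_differentiable_on_punctured_nhds_of_continuousAt ?_ ?_).differentiableAt
    · filter_upwards [self_mem_nhdsWithin] with z hz
      exact hoff z hz
    · unfold zetaReg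
      exact continuousAt_update_same.mpr riemannZeta_residue_one
  · exact hoff w hw

/-! ### A bump with non-vanishing Mellin transform at a given point -/

/-- For every `s₀` there is a smooth bump `ψ ≥ 0` supported in `[a, b] ⊂ (0, ∞)` with
`∫₀^∞ v^{-s₀-1} ψ(v) dv ≠ 0`: take `ψ` supported in `|v − 1| < δ` with `|v^{-s₀-1} − 1| < 1/2`
there, so that `|∫ v^{-s₀-1}ψ − ∫ψ| ≤ ½∫ψ < ∫ψ`. [folklore] -/
theorem exists_bump (s₀ : ℂ) : ∃ (ψ : ℝ → ℝ) (a b : ℝ), 0 < a ∧ ContDiff ℝ (⊤ : ℕ∞) ψ ∧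
    (∀ t, 0 ≤ ψ t) ∧ (∀ t, ψ t ≠ 0 → a ≤ t) ∧ (∀ t, ψ t ≠ 0 → t ≤ b) ∧
    mellin (fun v => (ψ v : ℂ)) (-s₀) ≠ 0 := by
  have hcont : ContinuousAt (fun t : ℝ => (t : ℂ) ^ (-s₀ - 1)) 1 :=
    continuousAt_ofReal_cpow_const 1 (-s₀ - 1) (Or.inr one_ne_zero)
  obtain ⟨δ₀, hδ₀, hδ₀'⟩ := Metric.continuousAt_iff.mp hcont (1 / 2) (by norm_num)
  set δ : ℝ := min δ₀ (1 / 2) with hδ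
  have hδpos : 0 < δ := lt_min hδ₀ (by norm_num)
  have hδle : δ ≤ 1 / 2 := min_le_right _ _
  have hδle' : δ ≤ δ₀ := min_le_left _ _
  let B : ContDiffBump (1 : ℝ) := ⟨δ / 2, δ, by positivity, by linarith⟩
  have hr : B.rOut = δ := rfl
  have hsupp : ∀ t, (B : ℝ → ℝ) t ≠ 0 → |t - 1| < δ := fun t ht => by
    have : t ∈ Function.support (B : ℝ → ℝ) := ht
    rwa [B.support_eq, Metric.mem_ball, Real.dist_eq, hr] at this
  have hψa : ∀ t, (B : ℝ → ℝ) t ≠ 0 → 1 - δ ≤ t := fun t ht => by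
    have := (abs_lt.mp (hsupp t ht)).1; linarith
  have hψb : ∀ t, (B : ℝ → ℝ) t ≠ 0 → t ≤ 1 + δ := fun t ht => by
    have := (abs_lt.mp (hsupp t ht)).2; linarith
  have ha : (0 : ℝ) < 1 - δ := by linarith
  have hψc : Continuous (B : ℝ → ℝ) := B.continuous
  refine ⟨B, 1 - δ, 1 + δ, ha, B.contDiff, fun t => B.nonneg, hψa, hψb, ?_⟩
  -- the Mellin value
  set J : ℝ := ∫ t, (B : ℝ → ℝ) t with hJ
  have hJpos : 0 < J := B.integral_pos
  have hzero : ∀ t ∉ Ioi (0 : ℝ), ((B t : ℝ) : ℂ) = 0 := by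
    intro t ht
    simp only [mem_Ioi, not_lt] at ht
    have : (B : ℝ → ℝ) t = 0 := by
      by_contra h
      have := hψa t h
      linarith
    simp [this]
  have hzero' : ∀ t ∉ Ioi (0 : ℝ), (1 / 2 : ℝ) * B t = 0 := by
    intro t ht
    have := hzero t ht
    simp only [ofReal_eq_zero] at this
    simp [this]
  have hJ' : ∫ t in Ioi (0 : ℝ), ((B t : ℝ) : ℂ) = (J : ℂ) := by
    rw [setIntegral_eq_integral_of_forall_compl_eq_zero hzero, integral_complex_ofReal]
  have hconv : MellinConvergent (fun v => ((B v : ℝ) : ℂ)) (-s₀) :=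
    mellinConvergent_bump hψc ha hψa hψb _
  have hint1 : Integrable (fun t : ℝ => (t : ℂ) ^ (-s₀ - 1) * ((B t : ℝ) : ℂ))
      (volume.restrict (Ioi 0)) := by
    simpa [MellinConvergent, smul_eq_mul, IntegrableOn] using hconv
  have hint2 : Integrable (fun t : ℝ => ((B t : ℝ) : ℂ)) (volume.restrict (Ioi 0)) :=
    ((continuous_ofReal.comp hψc).integrable_of_hasCompactSupport
      (B.hasCompactSupport.comp_left Complex.ofReal_zero)).integrableOn
  have hdiff : mellin (fun v => ((B v : ℝ) : ℂ)) (-s₀) - (J : ℂ) =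
      ∫ t in Ioi (0 : ℝ), ((t : ℂ) ^ (-s₀ - 1) - 1) * ((B t : ℝ) : ℂ) := by
    rw [← hJ', mellin]
    simp only [smul_eq_mul]
    rw [← integral_sub hint1 hint2]
    refine setIntegral_congr_fun measurableSet_Ioi fun t _ => ?_
    ring
  have hbound : ‖mellin (fun v => ((B v : ℝ) : ℂ)) (-s₀) - (J : ℂ)‖ ≤ J / 2 := by
    rw [hdiff]
    have hg : Integrable (fun t => (1 / 2 : ℝ) * B t) (volume.restrict (Ioi 0)) :=
      ((hψc.integrable_of_hasCompactSupport B.hasCompactSupport).const_mul _).integrableOn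
    calc ‖∫ t in Ioi (0 : ℝ), ((t : ℂ) ^ (-s₀ - 1) - 1) * ((B t : ℝ) : ℂ)‖
        ≤ ∫ t in Ioi (0 : ℝ), (1 / 2 : ℝ) * B t := by
          refine norm_integral_le_of_norm_le hg (ae_of_all _ fun t => ?_)
          rw [norm_mul, Complex.norm_real, Real.norm_of_nonneg B.nonneg]
          by_cases ht : (B : ℝ → ℝ) t = 0
          · simp [ht]
          · have h1 := hsupp t ht
            have h2 : dist t 1 < δ₀ := by rw [Real.dist_eq]; exact lt_of_lt_of_le h1 hδle'
            have h3 := hδ₀' h2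
            rw [Complex.ofReal_one, one_cpow, dist_eq_norm] at h3
            exact mul_le_mul_of_nonneg_right h3.le B.nonneg
      _ = (1 / 2) * ∫ t in Ioi (0 : ℝ), B t := integral_const_mul _ _
      _ = J / 2 := by
          rw [setIntegral_eq_integral_of_forall_compl_eq_zero (fun t ht => ?_), hJ]
          · ring
          · have := hzero t ht
            simpa using this
  intro h0
  rw [h0, zero_sub, norm_neg, Complex.norm_real, Real.norm_of_nonneg hJpos.le] at hbound
  linarith

/-! ### Mellin transform of an indicator -/

/-- `∫₀^∞ 1_{(0,Y]}(t) t^{w-1} dt = Y^w / w` for `re w > 0`, `Y > 0`, with convergence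
(Mathlib `hasMellin_one_Ioc`, rescaled). [folklore] -/
theorem hasMellin_indicator {Y : ℝ} (hY : 0 < Y) {w : ℂ} (hw : 0 < w.re) :
    MellinConvergent (Set.indicator (Ioc 0 Y) (fun _ => (1 : ℂ))) w ∧
      mellin (Set.indicator (Ioc 0 Y) (fun _ => (1 : ℂ))) w = (Y : ℂ) ^ w / w := by
  have h := hasMellin_one_Ioc hw
  have hfun : Set.indicator (Ioc 0 Y) (fun _ => (1 : ℂ)) =
      fun t => Set.indicator (Ioc 0 1) (fun _ => (1 : ℂ)) (Y⁻¹ * t) := by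
    ext t
    have hiff : t ∈ Ioc 0 Y ↔ Y⁻¹ * t ∈ Ioc (0 : ℝ) 1 := by
      rw [mem_Ioc, mem_Ioc, inv_mul_eq_div, div_le_one hY]
      constructor
      · rintro ⟨h1, h2⟩; exact ⟨div_pos h1 hY, h2⟩
      · rintro ⟨h1, h2⟩; exact ⟨(div_pos_iff_of_pos_right hY).mp h1, h2⟩
    by_cases ht : t ∈ Ioc 0 Y
    · rw [Set.indicator_of_mem ht, Set.indicator_of_mem (hiff.mp ht)]
    · rw [Set.indicator_of_notMem ht, Set.indicator_of_notMem (fun h => ht (hiff.mpr h))]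
  have harg : ((Y : ℂ)).arg ≠ Real.pi := by
    rw [Complex.arg_ofReal_of_nonneg hY.le]; exact Real.pi_ne_zero.symm
  constructor
  · rw [hfun]; exact (MellinConvergent.comp_mul_left (inv_pos.mpr hY)).mpr h.1
  · rw [hfun, mellin_comp_mul_left _ _ (inv_pos.mpr hY), h.2, smul_eq_mul, Complex.ofReal_inv,
      Complex.inv_cpow _ _ harg, cpow_neg, inv_inv]
    ring


/-! ### The main theorem -/

/-- **Discharge of `quasiRH_of_horocycleRate`** (Zagier 1981, §1 pp. 279–280, (Z2); Sarnak 1981,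
Thm. 1): for `1/2 ≤ θ ≤ 3/4`, if every smooth `SL(2,ℤ)`-invariant cusp-supported `F` has
`HorocycleRate θ`, then `ζ(s) ≠ 0` for `2 − 2θ < re s < 1`. See the module docstring for the
proof. [cite: Zagier1981, §1 pp. 279–280 (Z2: Θ ≤ 2(1−α))] -/
theorem quasiRH_of_horocycleRate_holds : quasiRH_of_horocycleRate := by
  intro θ hθ1 hθ2 hRate ρ hζ hρ1 hρ2
  -- the point `s₀ = ρ / 2`
  set s₀ : ℂ := ρ / 2 with hs₀
  have hs₀re : s₀.re = ρ.re / 2 := by simp [hs₀]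
  have hs₀1 : 1 - θ < s₀.re := by rw [hs₀re]; linarith
  have hs₀2 : s₀.re < 1 / 2 := by rw [hs₀re]; linarith
  have hρne : ρ ≠ 1 := fun h => by rw [h, one_re] at hρ2; exact lt_irrefl _ hρ2
  -- the bump and the test function
  obtain ⟨ψ, a, b, ha, hψ, hψ0, hψa, hψb, hM⟩ := exists_bump s₀
  have hψc : Continuous ψ := hψ.continuous
  obtain ⟨c₀, hc₀⟩ := hRate (incEis ψ) (contDiffOn_incEis ha hψa hψ) (fun g z => incEis_smul ψ g z)
    ⟨max b (1 / a), fun z _ hz => incEis_eq_zero_of_lt_im ha hψa hψb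
      (by rw [UpperHalfPlane.coe_im]; exact lt_of_le_of_lt (le_max_left _ _) hz)
      (by rw [UpperHalfPlane.coe_im]; exact lt_of_le_of_lt (le_max_right _ _) hz)⟩
  set C : ℝ → ℂ := fun y => ∫ x in (0 : ℝ)..1, incEis ψ (↑x + ↑y * I) with hC
  change ∀ ε : ℝ, 0 < ε → (fun y : ℝ => C y - c₀) =O[𝓝[>] 0] (fun y : ℝ => y ^ (θ - ε)) at hc₀
  -- vanishing for large `y`, continuity, and the unfolded formula
  set Y₁ : ℝ := max b (1 / a) + 1 with hY₁
  have hY₁pos : 0 < Y₁ := by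
    have : 0 < 1 / a := by positivity
    rw [hY₁]; linarith [le_max_right b (1 / a)]
  have hCzero : ∀ y : ℝ, Y₁ ≤ y → C y = 0 := by
    intro y hy
    have h1 : max b (1 / a) < y := by linarith
    have : ∀ x : ℝ, incEis ψ (↑x + ↑y * I) = 0 := fun x =>
      incEis_eq_zero_of_lt_im ha hψa hψb (by simpa using lt_of_le_of_lt (le_max_left _ _) h1)
        (by simpa using lt_of_le_of_lt (le_max_right _ _) h1)
    simp [hC, this]
  have hCcont : ContinuousOn C (Ioi 0) := continuousOn_horocycleAverage ha hψa hψ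
  set S : ℝ → ℂ := fun y => ((∑' c : ℕ, (c.totient : ℝ) * rowIntegral ψ c y : ℝ) : ℂ) with hS
  have hCformula : ∀ y : ℝ, 0 < y → C y = 2 * (ψ y : ℂ) + 2 * S y := by
    intro y hy
    simp only [hC, hS, horocycleAverage_incEis ha hψa hψc hy]
    push_cast
    ring
  -- `C₀ = C − c₀ 1_{(0, Y₁]}`
  set ind : ℝ → ℂ := Set.indicator (Ioc 0 Y₁) (fun _ => (1 : ℂ)) with hind
  set C₀ : ℝ → ℂ := fun y => C y - c₀ * ind y with hC₀
  have hCli : LocallyIntegrableOn C (Ioi 0) := hCcont.locallyIntegrableOn measurableSet_Ioi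
  have hind_int : IntegrableOn ind (Ioi 0) := by
    rw [hind, IntegrableOn, integrable_indicator_iff measurableSet_Ioc]
    exact integrableOn_const (by simp)
  have hC₀li : LocallyIntegrableOn C₀ (Ioi 0) := by
    have : C₀ = C - fun y => c₀ * ind y := by ext y; simp [hC₀]
    have h' : IntegrableOn (fun y => c₀ * ind y) (Ioi (0 : ℝ)) := hind_int.const_mul c₀
    rw [this]
    exact hCli.sub h'.locallyIntegrableOn
  have hC₀top : ∀ y, Y₁ < y → C₀ y = 0 := by
    intro y hy
    have : y ∉ Ioc 0 Y₁ := fun h => not_le.mpr hy h.2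
    simp [hC₀, hCzero y hy.le, hind, Set.indicator_of_notMem this]
  have hC₀bot : ∀ y ∈ Ioc (0 : ℝ) Y₁, C₀ y = C y - c₀ := by
    intro y hy; simp [hC₀, hind, Set.indicator_of_mem hy]
  -- `P(s) = ∫₀^∞ C₀(y) y^{s-2} dy` is holomorphic on `re s > 1 − θ`
  have hP : ∀ s : ℂ, 1 - θ < s.re → DifferentiableAt ℂ (fun s => mellin C₀ (s - 1)) s := by
    intro s hs
    set ε : ℝ := (s.re - (1 - θ)) / 2 with hε
    have hεpos : 0 < ε := by rw [hε]; linarith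
    have h1 : DifferentiableAt ℂ (mellin C₀) (s - 1) := by
      refine mellin_differentiableAt_of_isBigO_rpow (a := (s - 1).re + 1) (b := ε - θ) hC₀li ?_
        (by simp) ?_ ?_
      · refine (isBigO_zero _ _).congr' ?_ EventuallyEq.rfl
        filter_upwards [eventually_gt_atTop Y₁] with y hy
        exact (hC₀top y hy).symm
      · refine (hc₀ ε hεpos).congr' ?_ ?_
        · filter_upwards [Ioc_mem_nhdsGT hY₁pos] with y hy
          exact (hC₀bot y hy).symm
        · filter_upwards with y
          rw [neg_sub]
      · simp only [sub_re, one_re]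
        rw [hε]; linarith
    have h5 : DifferentiableAt ℂ (fun s : ℂ => s - 1) s := differentiableAt_id.sub_const 1
    have hcomp : (fun s => mellin C₀ (s - 1)) = (mellin C₀) ∘ (fun s : ℂ => s - 1) := rfl
    rw [hcomp]
    exact h1.comp s h5
  -- Mellin convergence of `C` for `re s > 1`
  have hCconv : ∀ s : ℂ, 1 < s.re → MellinConvergent C (s - 1) := by
    intro s hs
    refine mellinConvergent_of_isBigO_rpow (a := (s - 1).re + 1) (b := 0) hCli ?_ (by simp) ?_ ?_
    · refine (isBigO_zero _ _).congr' ?_ EventuallyEq.rfl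
      filter_upwards [eventually_ge_atTop Y₁] with y hy
      exact (hCzero y hy).symm
    · have hO := hc₀ (θ / 2) (by linarith)
      have h1 : (fun y : ℝ => y ^ (θ - θ / 2)) =O[𝓝[>] 0] (fun y : ℝ => y ^ (-(0 : ℝ))) := by
        refine IsBigO.of_bound 1 ?_
        filter_upwards [Ioo_mem_nhdsGT (zero_lt_one' ℝ)] with y hy
        rw [neg_zero, Real.rpow_zero, one_mul, norm_one,
          Real.norm_of_nonneg (Real.rpow_nonneg hy.1.le _)]
        exact Real.rpow_le_one hy.1.le hy.2.le (by linarith)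
      have h2 : (fun _ : ℝ => (c₀ : ℂ)) =O[𝓝[>] 0] (fun y : ℝ => y ^ (-(0 : ℝ))) := by
        refine IsBigO.of_bound ‖c₀‖ ?_
        filter_upwards with y
        simp
      have := (hO.trans h1).add h2
      simpa using this
    · simp only [sub_re, one_re]; linarith
  -- the Mellin identity on `re s > 1`
  set Mψ : ℂ → ℂ := mellin (fun v => (ψ v : ℂ)) with hMψ
  set T : ℂ → ℂ := fun s => ∑' c : ℕ, (c.totient : ℂ) * ((((c : ℝ) ^ 2 : ℝ) : ℂ) ^ (-s)) with hT
  have hId : ∀ s : ℂ, 1 < s.re →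
      mellin C (s - 1) = 2 * Mψ (s - 1) + 2 * (T s * (betaR s * Mψ (-s))) := by
    intro s hs
    have e2 : s - 1 - 1 = s - 2 := by ring
    have hIC : Integrable (fun y : ℝ => (y : ℂ) ^ (s - 2) * C y) (volume.restrict (Ioi 0)) := by
      have := hCconv s hs
      simpa [MellinConvergent, IntegrableOn, e2, smul_eq_mul] using this
    have hIψ : Integrable (fun y : ℝ => (y : ℂ) ^ (s - 2) * (2 * (ψ y : ℂ)))
        (volume.restrict (Ioi 0)) := by
      have := (mellinConvergent_bump hψc ha hψa hψb (s - 1)).const_mul (2 : ℂ)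
      simp only [e2, smul_eq_mul] at this
      refine this.congr (ae_of_all _ fun y => ?_)
      ring
    have hIS : Integrable (fun y : ℝ => (y : ℂ) ^ (s - 2) * (2 * S y)) (volume.restrict (Ioi 0)) := by
      refine (hIC.sub hIψ).congr ?_
      refine (ae_restrict_mem measurableSet_Ioi).mono fun y hy => ?_
      simp only [Pi.sub_apply, hCformula y hy]
      ring
    have step1 : mellin C (s - 1) = ∫ y in Ioi (0 : ℝ),
        ((y : ℂ) ^ (s - 2) * (2 * (ψ y : ℂ)) + (y : ℂ) ^ (s - 2) * (2 * S y)) := by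
      rw [mellin]
      refine setIntegral_congr_fun measurableSet_Ioi fun y hy => ?_
      simp only [e2, smul_eq_mul, hCformula y hy]
      ring
    have step2 : ∫ y in Ioi (0 : ℝ), (y : ℂ) ^ (s - 2) * (2 * (ψ y : ℂ)) = 2 * Mψ (s - 1) := by
      rw [hMψ, mellin]
      simp only [e2, smul_eq_mul]
      rw [← integral_const_mul]
      refine setIntegral_congr_fun measurableSet_Ioi fun y _ => ?_
      ring
    have hsum := hasSum_integral_rowSum hψc ha hψa hψb hψ0 hs
    have step3 : ∫ y in Ioi (0 : ℝ), (y : ℂ) ^ (s - 2) * (2 * S y) =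
        2 * (T s * (betaR s * Mψ (-s))) := by
      have h3 : ∫ y in Ioi (0 : ℝ), (y : ℂ) ^ (s - 2) * S y = T s * (betaR s * Mψ (-s)) := by
        rw [hS, hMψ, ← hsum.tsum_eq, hT, ← tsum_mul_right]
        refine tsum_congr fun c => ?_
        ring
      rw [← h3, ← integral_const_mul]
      refine setIntegral_congr_fun measurableSet_Ioi fun y _ => ?_
      ring
    rw [step1, integral_add hIψ hIS, step2, step3]
  -- the split `mellin C₀ (s-1) = mellin C (s-1) − c₀ Y₁^{s-1}/(s-1)` on `re s > 1`
  have hsplit : ∀ s : ℂ, 1 < s.re →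
      mellin C₀ (s - 1) = mellin C (s - 1) - c₀ * ((Y₁ : ℂ) ^ (s - 1) / (s - 1)) := by
    intro s hs
    obtain ⟨hi1, hi2⟩ := hasMellin_indicator hY₁pos (w := s - 1) (by simp only [sub_re, one_re]; linarith)
    have hC₀def : C₀ = fun y => C y - (fun y => c₀ • ind y) y := by ext y; simp [hC₀, smul_eq_mul]
    rw [hC₀def, (hasMellin_sub (hCconv s hs) (hi1.const_smul c₀)).2, mellin_const_smul, hi2,
      smul_eq_mul]
  -- the two analytic functions on `D = {re s > 1 − θ}`
  set D : Set ℂ := {s | 1 - θ < s.re} with hD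
  have hDopen : IsOpen D := isOpen_lt continuous_const Complex.continuous_re
  have hDconn : IsPreconnected D := (convex_halfSpace_re_gt (1 - θ)).isPreconnected
  set Bsharp : ℂ → ℂ := fun s =>
    2 * ((Real.sqrt Real.pi : ℝ) : ℂ) * Gamma (s + 1 / 2) * (Gamma s)⁻¹ with hBsharp
  set LHS : ℂ → ℂ := fun s => zetaReg (2 * s) *
    ((s - 1) * mellin C₀ (s - 1) + c₀ * (Y₁ : ℂ) ^ (s - 1) - 2 * ((s - 1) * Mψ (s - 1))) with hLHS
  set RHS : ℂ → ℂ := fun s => Bsharp s * zetaReg (2 * s - 1) * Mψ (-s) with hRHS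
  have hMψd : Differentiable ℂ Mψ := differentiable_mellin_bump hψc ha hψa hψb
  have hLHSd : DifferentiableOn ℂ LHS D := by
    intro s hs
    apply DifferentiableAt.differentiableWithinAt
    have h1 : DifferentiableAt ℂ (fun s => zetaReg (2 * s)) s :=
      (differentiable_zetaReg.comp (differentiable_id.const_mul (2 : ℂ))).differentiableAt
    have h2 := hP s hs
    have h3 : DifferentiableAt ℂ (fun s => (Y₁ : ℂ) ^ (s - 1)) s :=
      (differentiableAt_id.sub_const 1).const_cpow (Or.inl (by exact_mod_cast hY₁pos.ne'))
    have h4 : DifferentiableAt ℂ (fun s => Mψ (s - 1)) s :=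
      (hMψd.comp (differentiable_id.sub_const (1 : ℂ))).differentiableAt
    have h5 : DifferentiableAt ℂ (fun s : ℂ => s - 1) s := differentiableAt_id.sub_const 1
    exact h1.mul (((h5.mul h2).add (h3.const_mul c₀)).sub ((h5.mul h4).const_mul 2))
  have hRHSd : DifferentiableOn ℂ RHS D := by
    intro s hs
    have hs' : 1 - θ < s.re := hs
    apply DifferentiableAt.differentiableWithinAt
    have hG1 : DifferentiableAt ℂ (fun s => Gamma (s + 1 / 2)) s := by
      refine (Complex.differentiableAt_Gamma _ fun m h => ?_).comp s (differentiableAt_id.add_const _)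
      have := congrArg re h
      simp at this
      have hm : (0 : ℝ) ≤ m := m.cast_nonneg
      linarith
    have hG2 : DifferentiableAt ℂ (fun s => (Gamma s)⁻¹) s :=
      Complex.differentiable_one_div_Gamma.differentiableAt
    have hB : DifferentiableAt ℂ Bsharp s := ((hG1.const_mul _).mul hG2)
    have hZ : DifferentiableAt ℂ (fun s => zetaReg (2 * s - 1)) s :=
      (differentiable_zetaReg.comp ((differentiable_id.const_mul (2 : ℂ)).sub_const 1)).differentiableAt
    have hMn : DifferentiableAt ℂ (fun s => Mψ (-s)) s := (hMψd.comp differentiable_neg).differentiableAt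
    exact (hB.mul hZ).mul hMn
  -- they agree on `re s > 1`
  have hEq : ∀ s : ℂ, 1 < s.re → LHS s = RHS s := by
    intro s hs
    have hs2 : 2 * s ≠ 1 := by
      intro h; have := congrArg re h; simp at this; linarith
    have hs1 : 2 * s - 1 ≠ 1 := by
      intro h; have := congrArg re h; simp at this; linarith
    have hsne1 : s - 1 ≠ 0 := by
      intro h; have := congrArg re h; simp at this; linarith
    have hΓ : Gamma s ≠ 0 := Complex.Gamma_ne_zero_of_re_pos (by linarith)
    have hTζ : T s * riemannZeta (2 * s) = riemannZeta (2 * s - 1) := totientSum_mul_zeta hs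
    have hBG : betaR s * Gamma s = ((Real.sqrt Real.pi : ℝ) : ℂ) * Gamma (s - 1 / 2) :=
      betaR_mul_Gamma (by linarith)
    have hΓs : Gamma (s + 1 / 2) = (s - 1 / 2) * Gamma (s - 1 / 2) := by
      rw [show s + 1 / 2 = (s - 1 / 2) + 1 by ring, Complex.Gamma_add_one _ ?_]
      intro h; have := congrArg re h; simp at this; linarith
    have hBsharp_eq : Bsharp s = (2 * s - 1) * betaR s := by
      simp only [hBsharp]
      calc 2 * ((Real.sqrt Real.pi : ℝ) : ℂ) * Gamma (s + 1 / 2) * (Gamma s)⁻¹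
          = (2 * s - 1) * (((Real.sqrt Real.pi : ℝ) : ℂ) * Gamma (s - 1 / 2)) * (Gamma s)⁻¹ := by
            rw [hΓs]; ring
        _ = (2 * s - 1) * (betaR s * Gamma s) * (Gamma s)⁻¹ := by rw [hBG]
        _ = (2 * s - 1) * betaR s := by field_simp
    simp only [hLHS, hRHS]
    rw [hBsharp_eq, zetaReg_of_ne_one hs2, zetaReg_of_ne_one hs1, hsplit s hs, hId s hs, ← hTζ]
    field_simp
    ring
  have hEqOn : EqOn LHS RHS D := by
    have hA1 : AnalyticOnNhd ℂ LHS D := hLHSd.analyticOnNhd hDopen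
    have hA2 : AnalyticOnNhd ℂ RHS D := hRHSd.analyticOnNhd hDopen
    have h2D : (2 : ℂ) ∈ D := by
      show 1 - θ < (2 : ℂ).re
      simp; linarith
    refine hA1.eqOn_of_preconnected_of_eventuallyEq hA2 hDconn h2D ?_
    have hmem : {s : ℂ | 1 < s.re} ∈ 𝓝 (2 : ℂ) :=
      (isOpen_lt continuous_const Complex.continuous_re).mem_nhds (by simp)
    filter_upwards [hmem] with s hs
    exact hEq s hs
  -- evaluate at `s₀`
  have key := hEqOn (hs₀1 : s₀ ∈ D)
  have hL0 : LHS s₀ = 0 := by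
    have h2s₀ : 2 * s₀ = ρ := by rw [hs₀]; ring
    have : zetaReg (2 * s₀) = 0 := by
      rw [h2s₀, zetaReg_of_ne_one hρne, hζ, mul_zero]
    simp only [hLHS]
    rw [this, zero_mul]
  rw [hL0] at key
  have hR : RHS s₀ ≠ 0 := by
    have h2s₀ : 2 * s₀ - 1 = ρ - 1 := by rw [hs₀]; ring
    have hZ1 : zetaReg (2 * s₀ - 1) ≠ 0 := by
      rw [h2s₀, zetaReg_of_ne_one (by intro h; have := congrArg re h; simp at this; linarith)]
      refine mul_ne_zero (by intro h; have := congrArg re h; simp at this; linarith) ?_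
      intro h0
      obtain ⟨n, hn⟩ := (Literature.NumberTheory.LFunctions.riemannZeta_eq_zero_iff_of_re_nonpos
        (by simp only [sub_re, one_re]; linarith)).mp h0
      have := congrArg re hn
      simp at this
      have hn0 : (0 : ℝ) ≤ n := n.cast_nonneg
      linarith
    have hΓ1 : Gamma (s₀ + 1 / 2) ≠ 0 := Complex.Gamma_ne_zero_of_re_pos (by simp; linarith)
    have hΓ2 : (Gamma s₀)⁻¹ ≠ 0 := inv_ne_zero (Complex.Gamma_ne_zero_of_re_pos (by linarith))
    have hπ : ((Real.sqrt Real.pi : ℝ) : ℂ) ≠ 0 := by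
      exact_mod_cast (Real.sqrt_pos.mpr Real.pi_pos).ne'
    simp only [hRHS, hBsharp]
    exact mul_ne_zero (mul_ne_zero (mul_ne_zero (mul_ne_zero (mul_ne_zero two_ne_zero hπ) hΓ1)
      hΓ2) hZ1) hM
  exact hR key.symm

/-- **Discharge of `riemannHypothesis_of_horocycleRate_threeQuarters`** (Zagier 1981, §1
pp. 279–280: "if the error term … can be replaced by `O(y^{3/4−ε})` for all `U`, then the Riemann
hypothesis is true!"; Sarnak 1981, Thm. 1): the case `θ = 3/4` of
`quasiRH_of_horocycleRate_holds`, combined with `QuasiRH (1/2) ↔ RH`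
(`Literature.NumberTheory.LFunctions.quasiRiemannHypothesis_one_half_iff_holds`). [cite: Zagier1981, §1 pp. 279–280] -/
theorem riemannHypothesis_of_horocycleRate_threeQuarters_holds :
    riemannHypothesis_of_horocycleRate_threeQuarters :=
  riemannHypothesis_of_horocycleRate_threeQuarters_of quasiRH_of_horocycleRate_holds
    Literature.NumberTheory.LFunctions.quasiRiemannHypothesis_one_half_iff_holds

end Literature.NumberTheory.LFunctions
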